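import Summits.Schanuel.Schanuel.Theses.DiophantineDichotomy
import Summits.Schanuel.Schanuel.Theorems.EPiSimultaneousType.Negative.CoordinatewiseLinear
import Summits.Schanuel.Schanuel.Theorems.EPiSimultaneousType.Negative.BetaExpansion

/-!
# `EPiSimultaneousType`: the bounded-height (degree) aspect — β-expansion challengers
(negative lemmas for crux `stmt-Schanuel-6118`, route DiophantineDichotomy; cdisprove cycle 2)

UNCONDITIONAL content (no printed input, no hypothesis):

* `EPiSimultaneousType.exists_admissible_pair_height_three` — for every `n ≥ 2` an ADMISSIBLE
  pair (in the crux's exact clause) at level `(d, H) = (n², 3)` within `16e^{−n}` of `(π, e)`: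
  the two β-expansion roots (`Negative/BetaExpansion.lean`, each of degree `≤ n`, height `≤ 3`)
  in their compositum of degree `≤ n²` — bounded height, distance `exp(−√d)` inside a common
  number field of degree `≤ d`.
* `epiSimultaneousType_witness_bound` — the raw constraint `n − log 16 ≤ C((n²)ᵃ log 3 + (n²)ᵇ)`
  (all `n ≥ 2`) on every witness `(a, b, C)` of the crux's inequality.
* `epiSimultaneousType_false_of_exponents_lt_half` — **no witness `(a, b, C)` of the crux has
  `a < 1/2` and `b < 1/2`** (any real `C`). Cf. `Negative/RaceHalfFalse.lean`,
  `Negative/CoordinatewiseLinear.lean`: `a ≥ 1/2` alone is necessary MODULO Philippon's AP2 /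
  Bugeaud 2003; the joint constraint here is unconditional. (The crux normalises to `b ≥ 1`, so no
  honest witness is lost: this calibrates the degree aspect, `ω(d) ≍ √d` at bounded height, the
  `√d` being the compositum price exactly as at large height.)
* `epiSimultaneousType_false_firstCoordOnly_of_b_lt_one` — the FIRST-COORDINATE strengthening
  (sup norm replaced by `|γ₁ − π|`) is false for every `a < 1`, `b < 1`, `C` (level `d = n`,
  `γ = (r, 3)`): in the one-variable template the `d^b` term is necessary with `b ≥ 1`; the same
  holds verbatim for `|γ₂ − e|` (`1 < e < 4`). With Wirsing's theorem (not in Mathlib) the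
  one-coordinate template fails for every `a < 1` and every `b`: the crux lives on simultaneity.

* `epiSimultaneousType_false_without_fieldDegree_of_exponents_lt_one` — with the common-field
  clause `[ℚ(γ):ℚ] ≤ d` DELETED, no witness has `a < 1 ∧ b < 1` (unconditional companion of
  `epiSimultaneousType_false_without_fieldDegree_of_coordLinear`): the clause squares the level.

Everything is proved; axioms `propext`, `Classical.choice`, `Quot.sound`.
-/

set_option linter.dupNamespace false

noncomputable section

namespace Summit.Schanuel.Schanuel.Theorems

open Polynomial
open scoped IntermediateField

namespace EPiSimultaneousType

/-- **The bounded-height challengers**: for every `n ≥ 2` an ADMISSIBLE pair at level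
`(d, H) = (n², 3)` within `16 e^{−n}` of `(π, e)` — the two β-expansion roots (each of degree `≤ n`,
height `≤ 3`) in their compositum of degree `≤ n²`. [folklore] -/
theorem exists_admissible_pair_height_three {n : ℕ} (hn : 2 ≤ n) :
    ∃ γ : Fin 2 → ℂ, Module.finrank ℚ ↥(IntermediateField.adjoin ℚ (Set.range γ)) ≤ n ^ 2 ∧
      (∀ i, ∃ P : Polynomial ℤ, P ≠ 0 ∧ P.natDegree ≤ n ^ 2 ∧ (∀ k, |P.coeff k| ≤ ((3 : ℕ) : ℤ)) ∧
        Polynomial.aeval (γ i) P = 0) ∧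
      (∀ i, ∃ P : Polynomial ℤ, P ≠ 0 ∧ P.natDegree ≤ n ∧ (∀ k, |P.coeff k| ≤ ((3 : ℕ) : ℤ)) ∧
        Polynomial.aeval (γ i) P = 0) ∧
      ‖γ - ![(Real.pi : ℂ), (Real.exp 1 : ℂ)]‖ ≤ 16 * Real.exp (-(n : ℝ)) := by
  have he : Real.exp 1 < 4 := by
    have := Real.exp_one_lt_d9; norm_num at this; linarith
  have he1 : 1 < Real.exp 1 := by
    have := Real.exp_one_gt_d9; norm_num at this; linarith
  have hpi1 : 1 < Real.pi := by linarith [Real.pi_gt_three]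
  have hepi : Real.exp 1 ≤ Real.pi := by
    have := Real.exp_one_lt_d9; norm_num at this; linarith [Real.pi_gt_three]
  obtain ⟨r₁, hr₁, hcl₁⟩ := exists_clause_three_near hpi1 Real.pi_lt_four hn
  obtain ⟨r₂, hr₂, hcl₂⟩ := exists_clause_three_near he1 he hn
  set γ : Fin 2 → ℂ := ![(r₁ : ℂ), (r₂ : ℂ)] with hγ
  have hcl : ∀ i, ∃ P : Polynomial ℤ, P ≠ 0 ∧ P.natDegree ≤ n ∧
      (∀ k, |P.coeff k| ≤ ((3 : ℕ) : ℤ)) ∧ Polynomial.aeval (γ i) P = 0 := by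
    intro i
    fin_cases i
    · simpa [hγ] using hcl₁
    · simpa [hγ] using hcl₂
  have hn2 : n ≤ n ^ 2 := by nlinarith
  refine ⟨γ, finrank_adjoin_pair_le hcl, ?_, hcl, ?_⟩
  · intro i
    obtain ⟨P, hP0, hdeg, hH, hroot⟩ := hcl i
    exact ⟨P, hP0, hdeg.trans hn2, hH, hroot⟩
  · rw [Pi.norm_def]
    have h0 : ‖γ 0 - (Real.pi : ℂ)‖ ≤ 16 * Real.exp (-(n : ℝ)) := by
      simp only [hγ, Matrix.cons_val_zero]
      rw [← Complex.ofReal_sub, Complex.norm_real, Real.norm_eq_abs]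
      exact hr₁.trans (sq_div_pow_le hepi Real.pi_lt_four n)
    have h1 : ‖γ 1 - (Real.exp 1 : ℂ)‖ ≤ 16 * Real.exp (-(n : ℝ)) := by
      simp only [hγ, Matrix.cons_val_one, Matrix.cons_val_zero]
      rw [← Complex.ofReal_sub, Complex.norm_real, Real.norm_eq_abs]
      exact hr₂.trans (sq_div_pow_le le_rfl he n)
    have hnn : (0 : ℝ) ≤ 16 * Real.exp (-(n : ℝ)) := by positivity
    have : (Finset.univ.sup fun i : Fin 2 => ‖(γ - ![(Real.pi : ℂ), (Real.exp 1 : ℂ)]) i‖₊) ≤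
        ⟨16 * Real.exp (-(n : ℝ)), hnn⟩ := by
      apply Finset.sup_le
      intro i _
      fin_cases i
      · exact h0
      · exact h1
    exact_mod_cast this

/-- Growth lemma: for `s < 1`, `A kˢ + M < k` for some `k ≥ 2`. [folklore] -/
theorem exists_nat_rpow_lt_self {s : ℝ} (hs : s < 1) (A M : ℝ) :
    ∃ k : ℕ, 2 ≤ k ∧ A * (k : ℝ) ^ s + M < k := by
  have hten : Filter.Tendsto (fun x : ℝ => x ^ (1 - s)) Filter.atTop Filter.atTop :=
    tendsto_rpow_atTop (by linarith)
  have hev := (hten.comp tendsto_natCast_atTop_atTop).eventually_ge_atTop (2 * |A|)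
  have hevM := tendsto_natCast_atTop_atTop (R := ℝ) |>.eventually_gt_atTop (2 * M)
  obtain ⟨k, hk2, hkA, hkM⟩ := ((Filter.eventually_ge_atTop 2).and (hev.and hevM)).exists
  refine ⟨k, hk2, ?_⟩
  have hk0 : (0 : ℝ) < k := by exact_mod_cast (by omega : 0 < k)
  have hsplit : (k : ℝ) ^ s * (k : ℝ) ^ (1 - s) = k := by
    rw [← Real.rpow_add hk0]; simp
  have hkA' : 2 * |A| ≤ (k : ℝ) ^ (1 - s) := by simpa using hkA
  have h1 : A * (k : ℝ) ^ s ≤ (k : ℝ) / 2 := by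
    calc A * (k : ℝ) ^ s ≤ |A| * (k : ℝ) ^ s := by gcongr; exact le_abs_self A
      _ ≤ ((k : ℝ) ^ (1 - s) / 2) * (k : ℝ) ^ s := by gcongr; linarith
      _ = ((k : ℝ) ^ s * (k : ℝ) ^ (1 - s)) / 2 := by ring
      _ = k / 2 := by rw [hsplit]
  have h2 : 2 * M < (k : ℝ) := by simpa using hkM
  linarith

end EPiSimultaneousType

open EPiSimultaneousType

/-- **The raw constraint**: every witness `(a, b, C)` of the crux's inequality (no sign or size
conditions) satisfies `n − log 16 ≤ C((n²)ᵃ log 3 + (n²)ᵇ)` for every `n ≥ 2` — the β-expansion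
pair at level `(n², 3)` tested against the bound. Its asymptotic reading is the next theorem.
[folklore] -/
theorem epiSimultaneousType_witness_bound {a b C : ℝ}
    (hM : ∀ (d H : ℕ) (γ : Fin 2 → ℂ),
      Module.finrank ℚ ↥(IntermediateField.adjoin ℚ (Set.range γ)) ≤ d →
      (∀ i, ∃ P : Polynomial ℤ, P ≠ 0 ∧ P.natDegree ≤ d ∧ (∀ k, |P.coeff k| ≤ (H : ℤ)) ∧
        Polynomial.aeval (γ i) P = 0) →
      Real.exp (-(C * ((d : ℝ) ^ a * Real.log H + (d : ℝ) ^ b))) ≤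
        ‖γ - ![(Real.pi : ℂ), (Real.exp 1 : ℂ)]‖)
    {n : ℕ} (hn : 2 ≤ n) :
    (n : ℝ) - Real.log 16 ≤ C * (((n : ℝ) ^ 2) ^ a * Real.log 3 + ((n : ℝ) ^ 2) ^ b) := by
  obtain ⟨γ, hfin, hcl, -, hdist⟩ := exists_admissible_pair_height_three hn
  have h := (hM (n ^ 2) 3 γ hfin hcl).trans hdist
  have e16 : (16 : ℝ) * Real.exp (-(n : ℝ)) = Real.exp (Real.log 16 - n) := by
    rw [Real.exp_sub, Real.exp_log (by norm_num), Real.exp_neg, div_eq_mul_inv]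
  rw [e16, Real.exp_le_exp] at h
  push_cast at h
  linarith

/-- **No witness of `EPiSimultaneousType` has `a < 1/2` and `b < 1/2` — unconditionally.**
At bounded height `H = 3` the β-expansion pairs of level `d = n²` sit within `16e^{−n} = 16
exp(−√d)` of `(π, e)`, while a bound with `max(a, b) < 1/2` decays only like
`exp(−C(log 3 + 1) d^{max(a,b)})`. (The crux normalises to `b ≥ 1`, so this constrains no honest
witness; it certifies that in the DEGREE aspect at bounded height the pair `(π, e)` is
approximable to order `exp(−√d)` inside common number fields — the `√d` being the compositum
price, exactly as at large height — and it is the first constraint on `(a, b)` jointly that holds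
with no printed input. No `0 < C` hypothesis is needed.) [folklore] -/
theorem epiSimultaneousType_false_of_exponents_lt_half :
    ¬ ∃ a b C : ℝ, a < 1 / 2 ∧ b < 1 / 2 ∧ ∀ (d H : ℕ) (γ : Fin 2 → ℂ),
      Module.finrank ℚ ↥(IntermediateField.adjoin ℚ (Set.range γ)) ≤ d →
      (∀ i, ∃ P : Polynomial ℤ, P ≠ 0 ∧ P.natDegree ≤ d ∧ (∀ k, |P.coeff k| ≤ (H : ℤ)) ∧
        Polynomial.aeval (γ i) P = 0) →
      Real.exp (-(C * ((d : ℝ) ^ a * Real.log H + (d : ℝ) ^ b))) ≤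
        ‖γ - ![(Real.pi : ℂ), (Real.exp 1 : ℂ)]‖ := by
  rintro ⟨a, b, C, ha, hb, hM⟩
  set s : ℝ := max (max (2 * a) (2 * b)) 0 with hsdef
  have hs1 : s < 1 := max_lt (max_lt (by linarith) (by linarith)) one_pos
  have hs0 : 0 ≤ s := le_max_right _ _
  obtain ⟨n, hn2, hn⟩ := exists_nat_rpow_lt_self hs1 (|C| * (Real.log 3 + 1)) (Real.log 16)
  obtain ⟨γ, hfin, hcl, -, hdist⟩ := exists_admissible_pair_height_three hn2
  have hmeas := hM (n ^ 2) 3 γ hfin hcl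
  have hn0 : (0 : ℝ) < n := by exact_mod_cast (by omega : 0 < n)
  have hn1 : (1 : ℝ) ≤ n := by exact_mod_cast (by omega : 1 ≤ n)
  have hcast : ((n ^ 2 : ℕ) : ℝ) = (n : ℝ) ^ (2 : ℝ) := by push_cast; norm_cast
  rw [hcast] at hmeas
  have hpa : ((n : ℝ) ^ (2 : ℝ)) ^ a ≤ (n : ℝ) ^ s := by
    rw [← Real.rpow_mul hn0.le]
    exact Real.rpow_le_rpow_of_exponent_le hn1 (by rw [hsdef]; simp)
  have hpb : ((n : ℝ) ^ (2 : ℝ)) ^ b ≤ (n : ℝ) ^ s := by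
    rw [← Real.rpow_mul hn0.le]
    exact Real.rpow_le_rpow_of_exponent_le hn1 (by rw [hsdef]; simp)
  have hlog3 : 0 ≤ Real.log 3 := Real.log_nonneg (by norm_num)
  have hks : 0 ≤ (n : ℝ) ^ s := by positivity
  -- the exponent of the bound is at most |C| (log 3 + 1) n^s
  have hexp : C * (((n : ℝ) ^ (2 : ℝ)) ^ a * Real.log (3 : ℕ) + ((n : ℝ) ^ (2 : ℝ)) ^ b) ≤
      |C| * (Real.log 3 + 1) * (n : ℝ) ^ s := by
    have hin : 0 ≤ ((n : ℝ) ^ (2 : ℝ)) ^ a * Real.log (3 : ℕ) + ((n : ℝ) ^ (2 : ℝ)) ^ b := by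
      positivity
    calc C * (((n : ℝ) ^ (2 : ℝ)) ^ a * Real.log (3 : ℕ) + ((n : ℝ) ^ (2 : ℝ)) ^ b)
        ≤ |C| * (((n : ℝ) ^ (2 : ℝ)) ^ a * Real.log (3 : ℕ) + ((n : ℝ) ^ (2 : ℝ)) ^ b) := by
          gcongr; exact le_abs_self C
      _ ≤ |C| * ((n : ℝ) ^ s * Real.log 3 + (n : ℝ) ^ s) := by
          push_cast
          gcongr
      _ = |C| * (Real.log 3 + 1) * (n : ℝ) ^ s := by ring
  -- so the bound exceeds 16 e^{-n}
  have hlt : 16 * Real.exp (-(n : ℝ)) <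
      Real.exp (-(C * (((n : ℝ) ^ (2 : ℝ)) ^ a * Real.log (3 : ℕ) + ((n : ℝ) ^ (2 : ℝ)) ^ b))) := by
    have e16 : (16 : ℝ) * Real.exp (-(n : ℝ)) = Real.exp (Real.log 16 - n) := by
      rw [Real.exp_sub, Real.exp_log (by norm_num), Real.exp_neg, div_eq_mul_inv]
    rw [e16, Real.exp_lt_exp]
    linarith
  linarith [hmeas.trans hdist]

/-- **The FIRST-COORDINATE strengthening is false whenever `b < 1`** (any `a < 1`, any `C`):
replacing the sup norm `‖γ − (π, e)‖` by `|γ₁ − π|` alone (a measure carried by `π`'s coordinate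
only), the height-`3` β-expansion root of degree `n` paired with `γ₂ = r` (any admissible second
coordinate) is admissible at level `d = n²`… in fact already at level `d = n` with `γ₂ := 3`:
`|γ₁ − π| ≤ 16e^{−n}` against `exp(−C(nᵃ log 3 + nᵇ))`. So in the one-variable template the
`d^b` term is NECESSARY with `b ≥ 1` (the degree aspect at bounded height: Bugeaud 2004 §8.3);
with Wirsing's theorem (`w_n^*(π) ≥ (n+3)/2`, not in Mathlib) it is false for every `a < 1` and
every `b`. The crux survives only because it is simultaneous. [folklore] -/
theorem epiSimultaneousType_false_firstCoordOnly_of_b_lt_one :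
    ¬ ∃ a b C : ℝ, a < 1 ∧ b < 1 ∧ ∀ (d H : ℕ) (γ : Fin 2 → ℂ),
      Module.finrank ℚ ↥(IntermediateField.adjoin ℚ (Set.range γ)) ≤ d →
      (∀ i, ∃ P : Polynomial ℤ, P ≠ 0 ∧ P.natDegree ≤ d ∧ (∀ k, |P.coeff k| ≤ (H : ℤ)) ∧
        Polynomial.aeval (γ i) P = 0) →
      Real.exp (-(C * ((d : ℝ) ^ a * Real.log H + (d : ℝ) ^ b))) ≤ ‖γ 0 - (Real.pi : ℂ)‖ := by
  rintro ⟨a, b, C, ha, hb, hM⟩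
  set s : ℝ := max (max a b) 0 with hsdef
  have hs1 : s < 1 := max_lt (max_lt ha hb) one_pos
  obtain ⟨n, hn2, hn⟩ := exists_nat_rpow_lt_self hs1 (|C| * (Real.log 3 + 1)) (Real.log 16)
  have hpi1 : 1 < Real.pi := by linarith [Real.pi_gt_three]
  have hepi : Real.exp 1 ≤ Real.pi := by
    have := Real.exp_one_lt_d9; norm_num at this; linarith [Real.pi_gt_three]
  obtain ⟨r₁, hr₁, hcl₁⟩ := exists_clause_three_near hpi1 Real.pi_lt_four hn2
  -- second coordinate: the integer 3 (polynomial X - 3)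
  set γ : Fin 2 → ℂ := ![(r₁ : ℂ), ((3 : ℕ) : ℂ)] with hγ
  have hcl3 : ∃ P : Polynomial ℤ, P ≠ 0 ∧ P.natDegree ≤ n ∧ (∀ k, |P.coeff k| ≤ ((3 : ℕ) : ℤ)) ∧
      Polynomial.aeval (((3 : ℕ) : ℂ)) P = 0 := by
    refine ⟨Polynomial.X - Polynomial.C 3, Polynomial.X_sub_C_ne_zero 3,
      by rw [Polynomial.natDegree_X_sub_C]; omega, ?_, ?_⟩
    · intro k
      rw [Polynomial.coeff_sub, Polynomial.coeff_X, Polynomial.coeff_C]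
      split_ifs <;> norm_num
    · rw [map_sub, Polynomial.aeval_X, Polynomial.aeval_C]
      simp
  have hcl : ∀ i, ∃ P : Polynomial ℤ, P ≠ 0 ∧ P.natDegree ≤ n ∧
      (∀ k, |P.coeff k| ≤ ((3 : ℕ) : ℤ)) ∧ Polynomial.aeval (γ i) P = 0 := by
    intro i
    fin_cases i
    · simpa [hγ] using hcl₁
    · simpa [hγ] using hcl3
  -- field degree ≤ n: ℚ(r₁, 3) = ℚ(r₁)
  have hfin : Module.finrank ℚ ↥(IntermediateField.adjoin ℚ (Set.range γ)) ≤ n := by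
    obtain ⟨hint, h0⟩ := finrank_adjoin_simple_le_of_clause (hcl 0)
    have hle : IntermediateField.adjoin ℚ (Set.range γ) ≤ ℚ⟮γ 0⟯ := by
      rw [IntermediateField.adjoin_le_iff]
      rintro _ ⟨i, rfl⟩
      fin_cases i
      · exact IntermediateField.mem_adjoin_simple_self ℚ _
      · show γ 1 ∈ (ℚ⟮γ 0⟯ : IntermediateField ℚ ℂ)
        have : γ 1 = ((3 : ℕ) : ℂ) := by simp [hγ]
        rw [this]
        exact natCast_mem _ 3
    haveI : FiniteDimensional ℚ ↥ℚ⟮γ 0⟯ := IntermediateField.adjoin.finiteDimensional hint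
    exact (IntermediateField.finrank_le_of_le_right hle).trans h0
  have hmeas := hM n 3 γ hfin hcl
  have hdist : ‖γ 0 - (Real.pi : ℂ)‖ ≤ 16 * Real.exp (-(n : ℝ)) := by
    simp only [hγ, Matrix.cons_val_zero]
    rw [← Complex.ofReal_sub, Complex.norm_real, Real.norm_eq_abs]
    exact hr₁.trans (sq_div_pow_le hepi Real.pi_lt_four n)
  have hn0 : (0 : ℝ) < n := by exact_mod_cast (by omega : 0 < n)
  have hn1 : (1 : ℝ) ≤ n := by exact_mod_cast (by omega : 1 ≤ n)
  have hpa : (n : ℝ) ^ a ≤ (n : ℝ) ^ s :=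
    Real.rpow_le_rpow_of_exponent_le hn1 (by rw [hsdef]; simp)
  have hpb : (n : ℝ) ^ b ≤ (n : ℝ) ^ s :=
    Real.rpow_le_rpow_of_exponent_le hn1 (by rw [hsdef]; simp)
  have hlog3 : 0 ≤ Real.log 3 := Real.log_nonneg (by norm_num)
  have hexp : C * ((n : ℝ) ^ a * Real.log (3 : ℕ) + (n : ℝ) ^ b) ≤
      |C| * (Real.log 3 + 1) * (n : ℝ) ^ s := by
    have hin : 0 ≤ (n : ℝ) ^ a * Real.log (3 : ℕ) + (n : ℝ) ^ b := by positivity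
    calc C * ((n : ℝ) ^ a * Real.log (3 : ℕ) + (n : ℝ) ^ b)
        ≤ |C| * ((n : ℝ) ^ a * Real.log (3 : ℕ) + (n : ℝ) ^ b) := by
          gcongr; exact le_abs_self C
      _ ≤ |C| * ((n : ℝ) ^ s * Real.log 3 + (n : ℝ) ^ s) := by
          push_cast
          gcongr
      _ = |C| * (Real.log 3 + 1) * (n : ℝ) ^ s := by ring
  have hlt : 16 * Real.exp (-(n : ℝ)) <
      Real.exp (-(C * ((n : ℝ) ^ a * Real.log (3 : ℕ) + (n : ℝ) ^ b))) := by
    have e16 : (16 : ℝ) * Real.exp (-(n : ℝ)) = Real.exp (Real.log 16 - n) := by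
      rw [Real.exp_sub, Real.exp_log (by norm_num), Real.exp_neg, div_eq_mul_inv]
    rw [e16, Real.exp_lt_exp]
    linarith
  linarith [hmeas.trans hdist]

/-- **Without the COMMON-FIELD clause, no witness has `a < 1` and `b < 1`** — unconditionally
(cf. `epiSimultaneousType_false_without_fieldDegree_of_coordLinear` in
`Negative/CoordinatewiseLinear.lean`: every `a < 1`, any `b`, MODULO Bugeaud 2003 + `e ∈ S`):
with `[ℚ(γ₁, γ₂):ℚ] ≤ d` deleted, the β-expansion pair is a challenger at level `d = n` (not
`n²`), height `3`, distance `16e^{−n}`. The common-field clause is what squares the level.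
[folklore] -/
theorem epiSimultaneousType_false_without_fieldDegree_of_exponents_lt_one :
    ¬ ∃ a b C : ℝ, a < 1 ∧ b < 1 ∧ ∀ (d H : ℕ) (γ : Fin 2 → ℂ),
      (∀ i, ∃ P : Polynomial ℤ, P ≠ 0 ∧ P.natDegree ≤ d ∧ (∀ k, |P.coeff k| ≤ (H : ℤ)) ∧
        Polynomial.aeval (γ i) P = 0) →
      Real.exp (-(C * ((d : ℝ) ^ a * Real.log H + (d : ℝ) ^ b))) ≤
        ‖γ - ![(Real.pi : ℂ), (Real.exp 1 : ℂ)]‖ := by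
  rintro ⟨a, b, C, ha, hb, hM⟩
  set s : ℝ := max (max a b) 0 with hsdef
  have hs1 : s < 1 := max_lt (max_lt ha hb) one_pos
  obtain ⟨n, hn2, hn⟩ := exists_nat_rpow_lt_self hs1 (|C| * (Real.log 3 + 1)) (Real.log 16)
  obtain ⟨γ, -, -, hcl, hdist⟩ := exists_admissible_pair_height_three hn2
  have hmeas := hM n 3 γ hcl
  have hn1 : (1 : ℝ) ≤ n := by exact_mod_cast (by omega : 1 ≤ n)
  have hpa : (n : ℝ) ^ a ≤ (n : ℝ) ^ s :=
    Real.rpow_le_rpow_of_exponent_le hn1 (by rw [hsdef]; simp)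
  have hpb : (n : ℝ) ^ b ≤ (n : ℝ) ^ s :=
    Real.rpow_le_rpow_of_exponent_le hn1 (by rw [hsdef]; simp)
  have hlog3 : 0 ≤ Real.log 3 := Real.log_nonneg (by norm_num)
  have hexp : C * ((n : ℝ) ^ a * Real.log (3 : ℕ) + (n : ℝ) ^ b) ≤
      |C| * (Real.log 3 + 1) * (n : ℝ) ^ s := by
    have hin : 0 ≤ (n : ℝ) ^ a * Real.log (3 : ℕ) + (n : ℝ) ^ b := by positivity
    calc C * ((n : ℝ) ^ a * Real.log (3 : ℕ) + (n : ℝ) ^ b)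
        ≤ |C| * ((n : ℝ) ^ a * Real.log (3 : ℕ) + (n : ℝ) ^ b) := by
          gcongr; exact le_abs_self C
      _ ≤ |C| * ((n : ℝ) ^ s * Real.log 3 + (n : ℝ) ^ s) := by
          push_cast
          gcongr
      _ = |C| * (Real.log 3 + 1) * (n : ℝ) ^ s := by ring
  have hlt : 16 * Real.exp (-(n : ℝ)) <
      Real.exp (-(C * ((n : ℝ) ^ a * Real.log (3 : ℕ) + (n : ℝ) ^ b))) := by
    have e16 : (16 : ℝ) * Real.exp (-(n : ℝ)) = Real.exp (Real.log 16 - n) := by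
      rw [Real.exp_sub, Real.exp_log (by norm_num), Real.exp_neg, div_eq_mul_inv]
    rw [e16, Real.exp_lt_exp]
    linarith
  linarith [hmeas.trans hdist]

end Summit.Schanuel.Schanuel.Theorems

end
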